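import Literature.MathematicalPhysics.QuantumFieldTheory.Balaban1983to89.B5Lagrange149Torus
import Literature.MathematicalPhysics.QuantumFieldTheory.Balaban1983to89.Beta.FluctuationProjection

/-!
# `Balaban1983to89.B5Eq191LagrangeG` — [Balaban1984PropagatorsI] Sect. E p. 33: the Lagrange function (1.91),
the Lagrange system (1.92), its solution formula (1.93), and the sentence they serve — *"H_kB … is defined as
a minimum of the form ½⟨A, Δ_aA⟩ − a⟨B, B⟩ under the conditions QA = B, R∂*A = 0"* — TYPED WITH BODIES and
PROVED on the torus carriers of the `Balaban1983to89` B5 leaves (solution = (1.103) `H_kB = GQ*(QGQ*)⁻¹B`)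

statement-level skeleton of published theorems with citation tags; proofs where landed; nothing here is a claim about the Yang–Mills mass gap

CITATION HEADER.  T. Bałaban, *Propagators and renormalization transformations for lattice gauge theories. I*,
Commun. Math. Phys. **95** (1984) 17–40 [Balaban1984PropagatorsI] (= B5 of the series; PDF held
`paper:balaban1984-cmp95-propagators-rt-i`, journal page = PDF page + 16; p. 33 READ AS AN IMAGE on the ×2 render
`run/shared/lean/pub/pub-balaban/b2b-balaban-ref1/pages/1984-cmp95-propagators-rt-I/1984-cmp95-propagators-rt-I-p017-x2.png`).
Unit `lit-balaban-r02` gen 3 (reader/typer and fold owner of B5; HOME `run/shared/lean/pub/lit-balaban/`).  SKELETON row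
**B5.Eq1.93** ((1.91)–(1.93); status before this file: the printed INFERENCE «(1.95), (1.97) ⇒ the second equation of
(1.93) has the form Rλ = λ = 0» typed/proved abstractly `B5Identities197.eq198` (r02 gen 1) and on the torus
`B5Identities197Torus.eq198` (p21), (1.98) concrete; *"the Lagrange system (1.91)–(1.92) itself not transcribed"*).
Companion of `…B5Lagrange149Torus` (the SAME derivation pattern for Sect. D's (1.48)/(1.49), whose scalar products
`ipF`/`ipS`/`ipC` (1.21) and whose reading of «δh/δ·» as the linear parts of exact expansions are REUSED here) and of
`…Beta.FluctuationProjection` (`Hk` = the operator (1.103), `QGQ` = QGQ*).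

WHAT IS PRINTED (verbatim, p. 33 [PDF 17], after Proposition 1.1).  *"Let us now come back to the integral (1.68) and
to a calculation of H_kB. It is defined as a minimum of the form ½⟨A, Δ_aA⟩ − a⟨B, B⟩ under the conditions QA = B,
R∂*A = 0. We introduce the function
  h(A, ω, λ) = ½⟨A, Δ_aA⟩ + ⟨ω, QA − B⟩ + ⟨λ, R∂*A⟩,  Rλ = λ,   (1.91)
ω and λ are Lagrange multipliers, and we solve the equations
  δh/δA = Δ_aA + Q*ω + ∂λ = 0,  δh/δω = QA − B = 0,  δh/δλ = R∂*A = 0.   (1.92)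
We get
  A = −GQ*ω − G∂λ,  R∂*A = −R∂*GQ*ω − R∂*G∂λ = 0.   (1.93)"*
(then (1.94)–(1.97), and p. 34: *"The equalities (1.95), (1.97) imply that the second equation in (1.93) has the form
Rλ = λ = 0. Thus we have A = −GQ*ω, (1.98) … so finally we get the representation H_kB = GQ*(QGQ*)⁻¹B. (1.103)"*).

DICTIONARY (the torus conventions of the B5 leaves, as in `B5Lagrange149Torus` / `B5Identities197Torus`): `T_η =
Tor (fine n M)` (spacing η = n⁻¹ = L^{−k}), `T₁^{(k)} = Tor M`; vector fields `A : Tor (fine n M) × Fin d → ℂ`, block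
fields `B, ω : Tor M × Fin d → ℂ`, multiplier `λ : Tor (fine n M) → ℂ`; `Δ_a = B5DeltaA169.DeltaA n M a` ((1.69)),
`G = Δ_a⁻¹` ((1.71)), `Q = B5Block118.QvOp n M` ((1.18)), `Q* = B5DeltaA169.QvAdj n M` (the adjoint for the scalar
products (1.21)), `∂ = B5Action121.GradOp (fine n M) n`, `∂* = ∂ᴴ`; **`R`** enters as a PARAMETER `R : Matrix (T_η) (T_η) ℂ`
(as in p21's `B5Identities197Torus.opsWith R`), the theorems asking exactly the printed facts they use: `hRs : Rᴴ = R`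
(p. 25 «orthogonal projection»), `h95 : R∂*GQ* = 0` ((1.95)), `h97 : R∂*G∂ = R` ((1.97), left form) — for the
printed `R` = the p. 25 projection onto ΔN(Q′_k) = `B5Identities197Torus.RT n M` these are the tree theorems
`RT_conjTranspose`, `B5Identities197Torus.eq195_left`, `B5Identities197Torus.eq197_left` (one-line instantiation);
`QGQ* = Beta.FluctuationProjection.QGQ`, `H_k = Beta.FluctuationProjection.Hk = GQ*(QGQ*)⁻¹` ((1.103)); scalar
products `⟨·,·⟩` = `B5Lagrange149Torus.ipF n M` (vector fields on T_η, weight η^d), `ipC M` (unit lattice),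
`ipS n M` (scalars on T_η).  Real parts are taken because the tree's fields are complex-valued (for the paper's real
fields every term is real), exactly as in `B5Lagrange149Torus.hLag`.

WHAT THIS MODULE PROVIDES.  `form191` (the minimised form ½⟨A, Δ_aA⟩ − a⟨B, B⟩, def with body) · **`h191`** ((1.91),
def with body) · `h191_add_A` / `h191_add_omega` / `h191_add_lam` (the exact expansions whose linear parts are the
printed variations «δh/δA = Δ_aA + Q*ω + ∂λ», «δh/δω = QA − B», «δh/δλ = R∂*A») · **`EL192`** ((1.92) as a `Prop`,
def with body) · `el192_iff_stationary` ((1.92) ⟺ all three linear parts vanish identically) · **`eq193_of_el192`**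
((1.92) ⇒ (1.93), both displayed equations, with G = Δ_a⁻¹) · `el192_lam_eq_zero` / `el192_A_eq` ((1.93) with (1.95),
(1.97): «Rλ = λ = 0», (1.98) A = −GQ*ω) · `el192_omega_eq` (ω = −(QGQ*)⁻¹B) · **`el192_A_eq_Hk`** (the solution of
(1.92) IS (1.103) `H_kB`) · `el192_Hk` (conversely `(H_kB, −(QGQ*)⁻¹B, 0)` solves (1.92)) · `el192_iff` ·
**`form191_Hk_le`** / `form191_le_of_el192` (the Lagrange principle: the solution MINIMISES the form under the two
conditions — the sentence before (1.91)) · `form191_lt_of_ne` (strictly, Δ_a > 0: the minimiser is unique).  Theorems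
need `1 ≤ n`, `0 < a` (Δ_a invertible, Prop. 1.1) and, where used, `hRs`/`h95`/`h97`.  No `Prop`-valued fact, no
`sorry`; axioms standard.
-/

open scoped BigOperators Matrix ComplexConjugate ComplexOrder

namespace Literature.MathematicalPhysics.QuantumFieldTheory.Balaban1983to89.B5Eq191LagrangeG

open B5Prop11Plancherel (Tor fine calG)
open B5Action121 (GradOp dotProduct_mulVec_eq_star_conjTranspose_mulVec star_mulVec_dotProduct)
open B5Block118 (QvOp)
open B5DeltaA169 (QvAdj QvAdj_adjoint DeltaA DeltaA_isHermitian DeltaA_posSemidef DeltaA_posDef isUnit_DeltaA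
  calG_eq_DeltaA_inv)
open B5Value126 (PcT)
open B5Lagrange149Torus (ipF ipS ipC ipC_QvOp eq_zero_of_re_form)
open Beta.FluctuationProjection (QGQ QGQ_mul_inv QGQ_inv_mul Hk DeltaA_mul_Hk QvOp_Hk_mulVec)

noncomputable section

variable {d : ℕ} (n : ℕ) [NeZero n] (M : Fin d → ℕ) [hM : ∀ μ, NeZero (M μ)] (a : ℝ)
  (R : Matrix (Tor (fine n M)) (Tor (fine n M)) ℂ)

/-! ## §1 The form, the Lagrange function (1.91), its variations -/

/-- The minimised form of p. 33, verbatim: *"a minimum of the form ½⟨A, Δ_aA⟩ − a⟨B, B⟩ under the conditions QA = B,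
R∂*A = 0"* (real parts; `⟨B, B⟩` on the unit lattice). [cite: Balaban1984PropagatorsI, p.33 (before (1.91))] -/
def form191 (B : Tor M × Fin d → ℂ) (A : Tor (fine n M) × Fin d → ℂ) : ℝ :=
  1 / 2 * (ipF n M A (DeltaA n M a *ᵥ A)).re - a * (ipC M B B).re

/-- **THE LAGRANGE FUNCTION (1.91)** p. 33, verbatim: *"h(A, ω, λ) = ½⟨A, Δ_aA⟩ + ⟨ω, QA − B⟩ + ⟨λ, R∂*A⟩, Rλ = λ"*
(`R` the p. 25 projection, a parameter here; real parts as in `B5Lagrange149Torus.hLag`).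
[cite: Balaban1984PropagatorsI, (1.91) p.33] -/
def h191 (B : Tor M × Fin d → ℂ) (A : Tor (fine n M) × Fin d → ℂ) (ω : Tor M × Fin d → ℂ)
    (lam : Tor (fine n M) → ℂ) : ℝ :=
  1 / 2 * (ipF n M A (DeltaA n M a *ᵥ A)).re + (ipC M ω (QvOp n M *ᵥ A - B)).re
    + (ipS n M lam (R *ᵥ ((GradOp (fine n M) (n : ℂ))ᴴ *ᵥ A))).re

/-- `R` symmetric (`hRs`, p. 25 «orthogonal projection») and `Rλ = λ`, `∂* = (∂)ᴴ`: `⟨λ, R∂*A′⟩ = conj ⟨A′, ∂λ⟩`.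
[cite: Balaban1984PropagatorsI, (1.91) p.33 «Rλ = λ», p.25] -/
theorem ipS_R_divS (hRs : Rᴴ = R) (lam : Tor (fine n M) → ℂ) (hR : R *ᵥ lam = lam)
    (A' : Tor (fine n M) × Fin d → ℂ) :
    ipS n M lam (R *ᵥ ((GradOp (fine n M) (n : ℂ))ᴴ *ᵥ A'))
      = conj (ipF n M A' (GradOp (fine n M) (n : ℂ) *ᵥ lam)) := by
  rw [ipS, ipF, dotProduct_mulVec_eq_star_conjTranspose_mulVec, hRs, hR,
    dotProduct_mulVec_eq_star_conjTranspose_mulVec, Matrix.conjTranspose_conjTranspose, Matrix.star_dotProduct,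
    Complex.star_def, map_mul, map_inv₀, map_pow, map_natCast]

section Pos

variable (hn : 1 ≤ n) (ha : 0 < a)
include hn ha

/-- «Of course it is a symmetric operator» (p. 30): `⟨A, Δ_aA′⟩ = conj ⟨A′, Δ_aA⟩`.
[cite: Balaban1984PropagatorsI, p.30, (1.91) p.33] -/
theorem ipF_DeltaA_symm (A A' : Tor (fine n M) × Fin d → ℂ) :
    ipF n M A (DeltaA n M a *ᵥ A') = conj (ipF n M A' (DeltaA n M a *ᵥ A)) := by
  rw [ipF, ipF, dotProduct_mulVec_eq_star_conjTranspose_mulVec, (DeltaA_isHermitian n hn M a ha).eq,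
    Matrix.star_dotProduct, Complex.star_def, map_mul, map_inv₀, map_pow, map_natCast]

/-- **δh/δA (1.92)**: the exact expansion of `h` in `A` — linear part `⟨A′, Δ_aA + Q*ω + ∂λ⟩` (so «δh/δA = Δ_aA +
Q*ω + ∂λ»), quadratic part `½⟨A′, Δ_aA′⟩`; uses `Rλ = λ` and the symmetry of `Δ_a`.
[cite: Balaban1984PropagatorsI, (1.92) p.33] -/
theorem h191_add_A (hRs : Rᴴ = R) (B : Tor M × Fin d → ℂ) (A A' : Tor (fine n M) × Fin d → ℂ)
    (ω : Tor M × Fin d → ℂ) (lam : Tor (fine n M) → ℂ) (hR : R *ᵥ lam = lam) :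
    h191 n M a R B (A + A') ω lam
      = h191 n M a R B A ω lam
        + (ipF n M A' (DeltaA n M a *ᵥ A + QvAdj n M *ᵥ ω + GradOp (fine n M) (n : ℂ) *ᵥ lam)).re
        + 1 / 2 * (ipF n M A' (DeltaA n M a *ᵥ A')).re := by
  have h1 : (ipF n M A (DeltaA n M a *ᵥ A')).re = (ipF n M A' (DeltaA n M a *ᵥ A)).re := by
    rw [ipF_DeltaA_symm n M a hn ha, Complex.conj_re]
  have h2 : (ipC M ω (QvOp n M *ᵥ A')).re = (ipF n M A' (QvAdj n M *ᵥ ω)).re := by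
    rw [ipC_QvOp, Complex.conj_re]
  have h3 : (ipS n M lam (R *ᵥ ((GradOp (fine n M) (n : ℂ))ᴴ *ᵥ A'))).re
      = (ipF n M A' (GradOp (fine n M) (n : ℂ) *ᵥ lam)).re := by
    rw [ipS_R_divS n M R hRs lam hR, Complex.conj_re]
  have e1 : QvOp n M *ᵥ (A + A') - B = (QvOp n M *ᵥ A - B) + QvOp n M *ᵥ A' := by
    rw [Matrix.mulVec_add]; abel
  unfold h191
  rw [e1]
  simp only [ipF, ipC, ipS, Matrix.mulVec_add, dotProduct_add, star_add, add_dotProduct, mul_add,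
    Complex.add_re] at h1 h2 h3 ⊢
  linarith

end Pos

/-- **δh/δω (1.92)**: `h(A, ω + ω′, λ) = h(A, ω, λ) + ⟨ω′, QA − B⟩` (so «δh/δω = QA − B»).
[cite: Balaban1984PropagatorsI, (1.92) p.33] -/
theorem h191_add_omega (B : Tor M × Fin d → ℂ) (A : Tor (fine n M) × Fin d → ℂ) (ω ω' : Tor M × Fin d → ℂ)
    (lam : Tor (fine n M) → ℂ) :
    h191 n M a R B A (ω + ω') lam = h191 n M a R B A ω lam + (ipC M ω' (QvOp n M *ᵥ A - B)).re := by
  unfold h191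
  simp only [ipC, star_add, add_dotProduct, Complex.add_re]
  ring

/-- **δh/δλ (1.92)**: `h(A, ω, λ + λ′) = h(A, ω, λ) + ⟨λ′, R∂*A⟩` (so «δh/δλ = R∂*A»).
[cite: Balaban1984PropagatorsI, (1.92) p.33] -/
theorem h191_add_lam (B : Tor M × Fin d → ℂ) (A : Tor (fine n M) × Fin d → ℂ) (ω : Tor M × Fin d → ℂ)
    (lam lam' : Tor (fine n M) → ℂ) :
    h191 n M a R B A ω (lam + lam')
      = h191 n M a R B A ω lam + (ipS n M lam' (R *ᵥ ((GradOp (fine n M) (n : ℂ))ᴴ *ᵥ A))).re := by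
  unfold h191
  simp only [ipS, star_add, add_dotProduct, mul_add, Complex.add_re]
  ring

/-! ## §2 The Lagrange system (1.92) -/

/-- **THE LAGRANGE SYSTEM (1.92)** p. 33, verbatim: *"δh/δA = Δ_aA + Q*ω + ∂λ = 0, δh/δω = QA − B = 0, δh/δλ =
R∂*A = 0"* — as a proposition about `(A, ω, λ)` for the datum `B`. [cite: Balaban1984PropagatorsI, (1.92) p.33] -/
def EL192 (B : Tor M × Fin d → ℂ) (A : Tor (fine n M) × Fin d → ℂ) (ω : Tor M × Fin d → ℂ)
    (lam : Tor (fine n M) → ℂ) : Prop :=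
  DeltaA n M a *ᵥ A + QvAdj n M *ᵥ ω + GradOp (fine n M) (n : ℂ) *ᵥ lam = 0
  ∧ QvOp n M *ᵥ A - B = 0
  ∧ R *ᵥ ((GradOp (fine n M) (n : ℂ))ᴴ *ᵥ A) = 0

/-- **(1.92) ⟺ `h` IS STATIONARY**: the three linear parts of the expansions `h191_add_A`/`_omega`/`_lam` vanish
identically iff the three displayed equations hold. [cite: Balaban1984PropagatorsI, (1.92) p.33] -/
theorem el192_iff_stationary (B : Tor M × Fin d → ℂ) (A : Tor (fine n M) × Fin d → ℂ) (ω : Tor M × Fin d → ℂ)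
    (lam : Tor (fine n M) → ℂ) :
    EL192 n M a R B A ω lam ↔
      (∀ A', (ipF n M A' (DeltaA n M a *ᵥ A + QvAdj n M *ᵥ ω + GradOp (fine n M) (n : ℂ) *ᵥ lam)).re = 0)
      ∧ (∀ ω', (ipC M ω' (QvOp n M *ᵥ A - B)).re = 0)
      ∧ (∀ lam', (ipS n M lam' (R *ᵥ ((GradOp (fine n M) (n : ℂ))ᴴ *ᵥ A))).re = 0) := by
  have hr : (0 : ℝ) < ((n : ℝ) ^ d)⁻¹ := by
    have hn : (0 : ℝ) < n := by exact_mod_cast Nat.pos_of_ne_zero (NeZero.ne n)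
    positivity
  have hcast : (((n : ℂ) ^ d))⁻¹ = ((((n : ℝ) ^ d)⁻¹ : ℝ) : ℂ) := by push_cast; rfl
  unfold EL192
  constructor
  · rintro ⟨h1, h2, h3⟩
    refine ⟨fun A' => ?_, fun ω' => ?_, fun lam' => ?_⟩
    · rw [h1, ipF, dotProduct_zero, mul_zero, Complex.zero_re]
    · rw [h2, ipC, dotProduct_zero, Complex.zero_re]
    · rw [h3, ipS, dotProduct_zero, mul_zero, Complex.zero_re]
  · rintro ⟨h1, h2, h3⟩
    refine ⟨?_, ?_, ?_⟩
    · have h := h1 (DeltaA n M a *ᵥ A + QvAdj n M *ᵥ ω + GradOp (fine n M) (n : ℂ) *ᵥ lam)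
      rw [ipF, hcast] at h
      exact eq_zero_of_re_form hr _ h
    · have h := h2 (QvOp n M *ᵥ A - B)
      rw [ipC, ← one_mul (star _ ⬝ᵥ _), ← Complex.ofReal_one] at h
      exact eq_zero_of_re_form one_pos _ h
    · have h := h3 (R *ᵥ ((GradOp (fine n M) (n : ℂ))ᴴ *ᵥ A))
      rw [ipS, hcast] at h
      exact eq_zero_of_re_form hr _ h

/-! ## §3 (1.93), and the solution of (1.92): λ = 0, ω = −(QGQ*)⁻¹B, A = H_kB -/

section Solution

variable (hn : 1 ≤ n) (ha : 0 < a)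
include hn ha

/-- `GΔ_a = 1` (`G = Δ_a⁻¹`, Prop. 1.1 / (1.71)). [cite: Balaban1984PropagatorsI, (1.71) p.30] -/
theorem inv_mul_DeltaA : (DeltaA n M a)⁻¹ * DeltaA n M a = 1 :=
  Matrix.nonsing_inv_mul _ ((Matrix.isUnit_iff_isUnit_det _).mp (isUnit_DeltaA n hn M a ha))

/-- **(1.93)** p. 33, verbatim: *"We get A = −GQ*ω − G∂λ, R∂*A = −R∂*GQ*ω − R∂*G∂λ = 0"* — both displayed
equations follow from the first and the third equation of (1.92) (`G = Δ_a⁻¹`).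
[cite: Balaban1984PropagatorsI, (1.93) p.33] -/
theorem eq193_of_el192 {B : Tor M × Fin d → ℂ} {A : Tor (fine n M) × Fin d → ℂ} {ω : Tor M × Fin d → ℂ}
    {lam : Tor (fine n M) → ℂ} (h : EL192 n M a R B A ω lam) :
    A = -((DeltaA n M a)⁻¹ *ᵥ (QvAdj n M *ᵥ ω)) - (DeltaA n M a)⁻¹ *ᵥ (GradOp (fine n M) (n : ℂ) *ᵥ lam)
    ∧ R *ᵥ ((GradOp (fine n M) (n : ℂ))ᴴ *ᵥ A)
        = -(R *ᵥ ((GradOp (fine n M) (n : ℂ))ᴴ *ᵥ ((DeltaA n M a)⁻¹ *ᵥ (QvAdj n M *ᵥ ω))))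
          - R *ᵥ ((GradOp (fine n M) (n : ℂ))ᴴ *ᵥ ((DeltaA n M a)⁻¹ *ᵥ (GradOp (fine n M) (n : ℂ) *ᵥ lam)))
    ∧ R *ᵥ ((GradOp (fine n M) (n : ℂ))ᴴ *ᵥ A) = 0 := by
  obtain ⟨h1, -, h3⟩ := h
  have hA : A = -((DeltaA n M a)⁻¹ *ᵥ (QvAdj n M *ᵥ ω))
      - (DeltaA n M a)⁻¹ *ᵥ (GradOp (fine n M) (n : ℂ) *ᵥ lam) := by
    have e : DeltaA n M a *ᵥ A = -(QvAdj n M *ᵥ ω) - GradOp (fine n M) (n : ℂ) *ᵥ lam := by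
      linear_combination h1
    calc A = (DeltaA n M a)⁻¹ *ᵥ (DeltaA n M a *ᵥ A) := by
            rw [Matrix.mulVec_mulVec, inv_mul_DeltaA n M a hn ha, Matrix.one_mulVec]
      _ = _ := by rw [e, Matrix.mulVec_sub, Matrix.mulVec_neg]
  refine ⟨hA, ?_, h3⟩
  conv_lhs => rw [hA]
  rw [Matrix.mulVec_sub, Matrix.mulVec_neg, Matrix.mulVec_sub, Matrix.mulVec_neg]

/-- (1.93) ⇒ λ = 0 — p. 34: *"The equalities (1.95), (1.97) imply that the second equation in (1.93) has the form
Rλ = λ = 0"* (here from the hypotheses `h95`, `h97` on the parameter `R`).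
[cite: Balaban1984PropagatorsI, (1.93) p.33, (1.98) p.34] -/
theorem el192_lam_eq_zero
    (h95 : R * (GradOp (fine n M) (n : ℂ))ᴴ * (DeltaA n M a)⁻¹ * QvAdj n M = 0)
    (h97 : R * (GradOp (fine n M) (n : ℂ))ᴴ * (DeltaA n M a)⁻¹ * GradOp (fine n M) (n : ℂ) = R)
    {B : Tor M × Fin d → ℂ}
    {A : Tor (fine n M) × Fin d → ℂ} {ω : Tor M × Fin d → ℂ} {lam : Tor (fine n M) → ℂ} (hR : R *ᵥ lam = lam)
    (h : EL192 n M a R B A ω lam) : lam = 0 := by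
  obtain ⟨-, h2, h3⟩ := eq193_of_el192 n M a R hn ha h
  rw [h3] at h2
  -- the two terms of the second equation of (1.93): `R∂*GQ*ω = 0` by (1.95), `R∂*G∂λ = Rλ = λ` by (1.97)
  have t1 : R *ᵥ ((GradOp (fine n M) (n : ℂ))ᴴ *ᵥ ((DeltaA n M a)⁻¹ *ᵥ (QvAdj n M *ᵥ ω))) = 0 := by
    rw [Matrix.mulVec_mulVec, Matrix.mulVec_mulVec, Matrix.mulVec_mulVec]
    rw [h95, Matrix.zero_mulVec]
  have t2 : R *ᵥ ((GradOp (fine n M) (n : ℂ))ᴴ *ᵥ ((DeltaA n M a)⁻¹ *ᵥ (GradOp (fine n M) (n : ℂ) *ᵥ lam)))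
      = lam := by
    rw [Matrix.mulVec_mulVec, Matrix.mulVec_mulVec, Matrix.mulVec_mulVec]
    rw [h97, hR]
  rw [t1, t2, neg_zero, zero_sub] at h2
  exact neg_eq_zero.mp h2.symm

/-- **(1.98)** for the solution of (1.92): `A = −GQ*ω`. [cite: Balaban1984PropagatorsI, (1.98) p.34] -/
theorem el192_A_eq
    (h95 : R * (GradOp (fine n M) (n : ℂ))ᴴ * (DeltaA n M a)⁻¹ * QvAdj n M = 0)
    (h97 : R * (GradOp (fine n M) (n : ℂ))ᴴ * (DeltaA n M a)⁻¹ * GradOp (fine n M) (n : ℂ) = R)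
    {B : Tor M × Fin d → ℂ}
    {A : Tor (fine n M) × Fin d → ℂ} {ω : Tor M × Fin d → ℂ} {lam : Tor (fine n M) → ℂ} (hR : R *ᵥ lam = lam)
    (h : EL192 n M a R B A ω lam) : A = -((DeltaA n M a)⁻¹ *ᵥ (QvAdj n M *ᵥ ω)) := by
  have hl := el192_lam_eq_zero n M a R hn ha h95 h97 hR h
  have hA := (eq193_of_el192 n M a R hn ha h).1
  rw [hl, Matrix.mulVec_zero, Matrix.mulVec_zero, sub_zero] at hA
  exact hA

/-- p. 34, (1.102): the second equation `QA = B` then determines `ω = −(QGQ*)⁻¹B` (*"We have to satisfy yet the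
condition QA = B"*). [cite: Balaban1984PropagatorsI, (1.102) p.34] -/
theorem el192_omega_eq
    (h95 : R * (GradOp (fine n M) (n : ℂ))ᴴ * (DeltaA n M a)⁻¹ * QvAdj n M = 0)
    (h97 : R * (GradOp (fine n M) (n : ℂ))ᴴ * (DeltaA n M a)⁻¹ * GradOp (fine n M) (n : ℂ) = R)
    {B : Tor M × Fin d → ℂ}
    {A : Tor (fine n M) × Fin d → ℂ} {ω : Tor M × Fin d → ℂ} {lam : Tor (fine n M) → ℂ} (hR : R *ᵥ lam = lam)
    (h : EL192 n M a R B A ω lam) : ω = -((QGQ n hn M a ha)⁻¹ *ᵥ B) := by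
  have hA := el192_A_eq n M a R hn ha h95 h97 hR h
  obtain ⟨-, h2, -⟩ := h
  rw [sub_eq_zero, hA, Matrix.mulVec_neg, Matrix.mulVec_mulVec, Matrix.mulVec_mulVec,
    ← calG_eq_DeltaA_inv n hn M a ha] at h2
  -- `h2 : −(QGQ* ω) = B`
  have e : QGQ n hn M a ha *ᵥ ω = -B := by
    rw [← h2, neg_neg]; rfl
  calc ω = (QGQ n hn M a ha)⁻¹ *ᵥ (QGQ n hn M a ha *ᵥ ω) := by
          rw [Matrix.mulVec_mulVec, QGQ_inv_mul n hn M a ha, Matrix.one_mulVec]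
    _ = -((QGQ n hn M a ha)⁻¹ *ᵥ B) := by rw [e, Matrix.mulVec_neg]

/-- **THE SOLUTION OF (1.92) IS (1.103)**: `A = GQ*(QGQ*)⁻¹B = H_kB` (`Beta.FluctuationProjection.Hk`).
[cite: Balaban1984PropagatorsI, (1.103) p.34] -/
theorem el192_A_eq_Hk
    (h95 : R * (GradOp (fine n M) (n : ℂ))ᴴ * (DeltaA n M a)⁻¹ * QvAdj n M = 0)
    (h97 : R * (GradOp (fine n M) (n : ℂ))ᴴ * (DeltaA n M a)⁻¹ * GradOp (fine n M) (n : ℂ) = R)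
    {B : Tor M × Fin d → ℂ}
    {A : Tor (fine n M) × Fin d → ℂ} {ω : Tor M × Fin d → ℂ} {lam : Tor (fine n M) → ℂ} (hR : R *ᵥ lam = lam)
    (h : EL192 n M a R B A ω lam) : A = Hk n hn M a ha *ᵥ B := by
  rw [el192_A_eq n M a R hn ha h95 h97 hR h, el192_omega_eq n M a R hn ha h95 h97 hR h, Matrix.mulVec_neg,
    Matrix.mulVec_neg,
    neg_neg, Hk, calG_eq_DeltaA_inv n hn M a ha, ← Matrix.mulVec_mulVec, ← Matrix.mulVec_mulVec]

/-- Conversely `(H_kB, −(QGQ*)⁻¹B, 0)` SOLVES (1.92): `Δ_aH_kB = Q*(QGQ*)⁻¹B`, `QH_kB = B`, `R∂*H_kB = 0` («the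
condition R∂*A = 0 is satisfied automatically», p. 34). [cite: Balaban1984PropagatorsI, (1.92) p.33, (1.103) p.34] -/
theorem el192_Hk (h95 : R * (GradOp (fine n M) (n : ℂ))ᴴ * (DeltaA n M a)⁻¹ * QvAdj n M = 0) (B : Tor M × Fin d → ℂ) :
    EL192 n M a R B (Hk n hn M a ha *ᵥ B) (-((QGQ n hn M a ha)⁻¹ *ᵥ B)) 0 := by
  refine ⟨?_, ?_, ?_⟩
  · rw [Matrix.mulVec_zero, add_zero, Matrix.mulVec_mulVec, DeltaA_mul_Hk n hn M a ha, Matrix.mulVec_neg,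
      Matrix.mulVec_mulVec, add_neg_cancel]
  · rw [QvOp_Hk_mulVec n hn M a ha, sub_self]
  · -- «the condition R∂*A = 0 is satisfied automatically» by (1.95): `R∂*·H_k = (R∂*GQ*)·(QGQ*)⁻¹ = 0`
    have : R * (GradOp (fine n M) (n : ℂ))ᴴ * Hk n hn M a ha = 0 := by
      rw [Hk, calG_eq_DeltaA_inv n hn M a ha, ← Matrix.mul_assoc, ← Matrix.mul_assoc, h95, Matrix.zero_mul]
    rw [Matrix.mulVec_mulVec, Matrix.mulVec_mulVec, this, Matrix.zero_mulVec]

/-- (1.92) with `Rλ = λ` has EXACTLY ONE solution: `(A, ω, λ) = (H_kB, −(QGQ*)⁻¹B, 0)`.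
[cite: Balaban1984PropagatorsI, (1.92) p.33, (1.103) p.34] -/
theorem el192_iff
    (h95 : R * (GradOp (fine n M) (n : ℂ))ᴴ * (DeltaA n M a)⁻¹ * QvAdj n M = 0)
    (h97 : R * (GradOp (fine n M) (n : ℂ))ᴴ * (DeltaA n M a)⁻¹ * GradOp (fine n M) (n : ℂ) = R)
    (B : Tor M × Fin d → ℂ)
    (A : Tor (fine n M) × Fin d → ℂ) (ω : Tor M × Fin d → ℂ) (lam : Tor (fine n M) → ℂ) (hR : R *ᵥ lam = lam) :
    EL192 n M a R B A ω lam ↔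
      A = Hk n hn M a ha *ᵥ B ∧ ω = -((QGQ n hn M a ha)⁻¹ *ᵥ B) ∧ lam = 0 := by
  constructor
  · intro h
    exact ⟨el192_A_eq_Hk n M a R hn ha h95 h97 hR h, el192_omega_eq n M a R hn ha h95 h97 hR h,
      el192_lam_eq_zero n M a R hn ha h95 h97 hR h⟩
  · rintro ⟨rfl, rfl, rfl⟩
    exact el192_Hk n M a R hn ha h95 B

/-! ## §4 The Lagrange principle: the solution minimises the form under the two conditions -/

/-- **SUFFICIENCY OF (1.92)**: a solution `(A, ω, λ)` of (1.92) with `Rλ = λ` MINIMISES *"the form ½⟨A, Δ_aA⟩ −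
a⟨B, B⟩ under the conditions QA = B, R∂*A = 0"* — from the expansion `h191_add_A`: on the constraint set the linear
part is `−⟨QA′, ω⟩ − ⟨R∂*A′, λ⟩ = 0` and the quadratic part is `½⟨A′, Δ_aA′⟩ ≥ 0` (Δ_a ≥ 0, p. 30).
[cite: Balaban1984PropagatorsI, p.33 (before (1.91))] -/
theorem form191_le_of_el192 (hRs : Rᴴ = R) {B : Tor M × Fin d → ℂ} {A : Tor (fine n M) × Fin d → ℂ}
    {ω : Tor M × Fin d → ℂ} {lam : Tor (fine n M) → ℂ} (hR : R *ᵥ lam = lam) (h : EL192 n M a R B A ω lam)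
    (A₁ : Tor (fine n M) × Fin d → ℂ) (hA₁ : QvOp n M *ᵥ A₁ = B)
    (hR₁ : R *ᵥ ((GradOp (fine n M) (n : ℂ))ᴴ *ᵥ A₁) = 0) :
    form191 n M a B A ≤ form191 n M a B A₁ := by
  have hnd : (((n : ℂ) ^ d))⁻¹ ≠ 0 := inv_ne_zero (pow_ne_zero _ (by exact_mod_cast NeZero.ne n))
  have hr : (0 : ℝ) < ((n : ℝ) ^ d)⁻¹ := by
    have hn' : (0 : ℝ) < n := by exact_mod_cast Nat.pos_of_ne_zero (NeZero.ne n)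
    positivity
  obtain ⟨h1, h2, h3⟩ := h
  set A' := A₁ - A with hA'
  have hQ : QvOp n M *ᵥ A' = 0 := by
    rw [hA', Matrix.mulVec_sub, hA₁, ← sub_eq_zero.mp h2, sub_self]
  have hRA' : R *ᵥ ((GradOp (fine n M) (n : ℂ))ᴴ *ᵥ A') = 0 := by
    rw [hA', Matrix.mulVec_sub, Matrix.mulVec_sub, hR₁, h3, sub_self]
  -- the linear part vanishes on the constraint set `{QA′ = 0, R∂*A′ = 0}`
  have e : DeltaA n M a *ᵥ A = -(QvAdj n M *ᵥ ω + GradOp (fine n M) (n : ℂ) *ᵥ lam) := by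
    rw [eq_neg_iff_add_eq_zero, ← add_assoc, h1]
  have hω : star A' ⬝ᵥ (QvAdj n M *ᵥ ω) = 0 := by
    have h := ipC_QvOp n M A' ω
    rw [hQ, ipC, dotProduct_zero] at h
    have h' := congrArg conj h
    rw [map_zero, Complex.conj_conj, ipF] at h'
    exact (mul_eq_zero.mp h'.symm).resolve_left hnd
  have hl : star A' ⬝ᵥ (GradOp (fine n M) (n : ℂ) *ᵥ lam) = 0 := by
    have h := ipS_R_divS n M R hRs lam hR A'
    rw [hRA', ipS, dotProduct_zero, mul_zero] at h
    have h' := congrArg conj h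
    rw [map_zero, Complex.conj_conj, ipF] at h'
    exact (mul_eq_zero.mp h'.symm).resolve_left hnd
  have hlin : (ipF n M A' (DeltaA n M a *ᵥ A + QvAdj n M *ᵥ ω + GradOp (fine n M) (n : ℂ) *ᵥ lam)).re = 0 := by
    rw [e, ipF]
    simp only [neg_add_rev, dotProduct_add, dotProduct_neg, hω, hl, neg_zero, add_zero, mul_zero,
      Complex.zero_re]
  -- the quadratic part is non-negative
  have hquad : 0 ≤ (ipF n M A' (DeltaA n M a *ᵥ A')).re := by
    have hps := (DeltaA_posSemidef n hn M a ha).re_dotProduct_nonneg A'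
    rw [RCLike.re_to_complex] at hps
    rw [ipF, show (((n : ℂ) ^ d))⁻¹ = ((((n : ℝ) ^ d)⁻¹ : ℝ) : ℂ) by push_cast; rfl, Complex.re_ofReal_mul]
    exact mul_nonneg hr.le hps
  -- `h` at `A₁ = A + A′` versus at `A`: on the constraint set `h = form + a⟨B,B⟩`-type bookkeeping is not needed,
  -- we compare the quadratic terms directly
  have hexp := h191_add_A n M a R hn ha hRs B A A' ω lam hR
  have hAA : A + A' = A₁ := by rw [hA']; abel
  rw [hAA] at hexp
  -- unfold `h191` at both fields: the ω- and λ-terms coincide on the constraint set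
  have hω₁ : (ipC M ω (QvOp n M *ᵥ A₁ - B)).re = (ipC M ω (QvOp n M *ᵥ A - B)).re := by
    rw [hA₁, sub_eq_zero.mp h2]
  have hl₁ : (ipS n M lam (R *ᵥ ((GradOp (fine n M) (n : ℂ))ᴴ *ᵥ A₁))).re
      = (ipS n M lam (R *ᵥ ((GradOp (fine n M) (n : ℂ))ᴴ *ᵥ A))).re := by
    rw [hR₁, h3]
  unfold h191 at hexp
  unfold form191
  linarith

/-- **`H_kB` MINIMISES the form** ½⟨A, Δ_aA⟩ − a⟨B, B⟩ under QA = B, R∂*A = 0 — the sentence before (1.91) for the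
operator (1.103), torus carriers. [cite: Balaban1984PropagatorsI, p.33 (before (1.91)), (1.103) p.34] -/
theorem form191_Hk_le (hRs : Rᴴ = R)
    (h95 : R * (GradOp (fine n M) (n : ℂ))ᴴ * (DeltaA n M a)⁻¹ * QvAdj n M = 0)
    (B : Tor M × Fin d → ℂ)
    (A₁ : Tor (fine n M) × Fin d → ℂ) (hA₁ : QvOp n M *ᵥ A₁ = B)
    (hR₁ : R *ᵥ ((GradOp (fine n M) (n : ℂ))ᴴ *ᵥ A₁) = 0) :
    form191 n M a B (Hk n hn M a ha *ᵥ B) ≤ form191 n M a B A₁ :=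
  form191_le_of_el192 n M a R hn ha hRs (lam := 0) (by rw [Matrix.mulVec_zero]) (el192_Hk n M a R hn ha h95 B)
    A₁ hA₁ hR₁

/-- … and STRICTLY unless `A₁ = H_kB` (Δ_a > 0, Prop. 1.1): the constrained minimiser is unique.
[cite: Balaban1984PropagatorsI, p.33 (before (1.91)), Prop. 1.1 p.33] -/
theorem form191_lt_of_ne (hRs : Rᴴ = R)
    (h95 : R * (GradOp (fine n M) (n : ℂ))ᴴ * (DeltaA n M a)⁻¹ * QvAdj n M = 0)
    (B : Tor M × Fin d → ℂ)
    (A₁ : Tor (fine n M) × Fin d → ℂ) (hA₁ : QvOp n M *ᵥ A₁ = B)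
    (hR₁ : R *ᵥ ((GradOp (fine n M) (n : ℂ))ᴴ *ᵥ A₁) = 0) (hne : A₁ ≠ Hk n hn M a ha *ᵥ B) :
    form191 n M a B (Hk n hn M a ha *ᵥ B) < form191 n M a B A₁ := by
  have hnd : (((n : ℂ) ^ d))⁻¹ ≠ 0 := inv_ne_zero (pow_ne_zero _ (by exact_mod_cast NeZero.ne n))
  have hr : (0 : ℝ) < ((n : ℝ) ^ d)⁻¹ := by
    have hn' : (0 : ℝ) < n := by exact_mod_cast Nat.pos_of_ne_zero (NeZero.ne n)
    positivity
  set A := Hk n hn M a ha *ᵥ B with hAdef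
  obtain ⟨h1, h2, h3⟩ := el192_Hk n M a R hn ha h95 B
  set A' := A₁ - A with hA'
  have hA'ne : A' ≠ 0 := fun h0 => hne (sub_eq_zero.mp (by rw [← hA']; exact h0))
  have hQ : QvOp n M *ᵥ A' = 0 := by
    rw [hA', Matrix.mulVec_sub, hA₁, ← sub_eq_zero.mp h2, sub_self]
  have hRA' : R *ᵥ ((GradOp (fine n M) (n : ℂ))ᴴ *ᵥ A') = 0 := by
    rw [hA', Matrix.mulVec_sub, Matrix.mulVec_sub, hR₁, h3, sub_self]
  have e : DeltaA n M a *ᵥ A = -(QvAdj n M *ᵥ (-((QGQ n hn M a ha)⁻¹ *ᵥ B))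
      + GradOp (fine n M) (n : ℂ) *ᵥ (0 : Tor (fine n M) → ℂ)) := by
    rw [eq_neg_iff_add_eq_zero, ← add_assoc, h1]
  have hω : star A' ⬝ᵥ (QvAdj n M *ᵥ (-((QGQ n hn M a ha)⁻¹ *ᵥ B))) = 0 := by
    have h := ipC_QvOp n M A' (-((QGQ n hn M a ha)⁻¹ *ᵥ B))
    rw [hQ, ipC, dotProduct_zero] at h
    have h' := congrArg conj h
    rw [map_zero, Complex.conj_conj, ipF] at h'
    exact (mul_eq_zero.mp h'.symm).resolve_left hnd
  have hlin : (ipF n M A' (DeltaA n M a *ᵥ A + QvAdj n M *ᵥ (-((QGQ n hn M a ha)⁻¹ *ᵥ B))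
      + GradOp (fine n M) (n : ℂ) *ᵥ (0 : Tor (fine n M) → ℂ))).re = 0 := by
    rw [e, ipF]
    simp only [Matrix.mulVec_zero, add_zero, dotProduct_add, dotProduct_neg, hω, neg_zero,
      mul_zero, Complex.zero_re]
  have hquad : 0 < (ipF n M A' (DeltaA n M a *ᵥ A')).re := by
    have hps := (DeltaA_posDef n hn M a ha).re_dotProduct_pos hA'ne
    rw [RCLike.re_to_complex] at hps
    rw [ipF, show (((n : ℂ) ^ d))⁻¹ = ((((n : ℝ) ^ d)⁻¹ : ℝ) : ℂ) by push_cast; rfl, Complex.re_ofReal_mul]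
    exact mul_pos hr hps
  have hexp := h191_add_A n M a R hn ha hRs B A A' (-((QGQ n hn M a ha)⁻¹ *ᵥ B)) 0 (by rw [Matrix.mulVec_zero])
  have hAA : A + A' = A₁ := by rw [hA']; abel
  rw [hAA] at hexp
  have hω₁ : (ipC M (-((QGQ n hn M a ha)⁻¹ *ᵥ B)) (QvOp n M *ᵥ A₁ - B)).re
      = (ipC M (-((QGQ n hn M a ha)⁻¹ *ᵥ B)) (QvOp n M *ᵥ A - B)).re := by
    rw [hA₁, sub_eq_zero.mp h2]
  have hl₁ : (ipS n M (0 : Tor (fine n M) → ℂ) (R *ᵥ ((GradOp (fine n M) (n : ℂ))ᴴ *ᵥ A₁))).re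
      = (ipS n M (0 : Tor (fine n M) → ℂ) (R *ᵥ ((GradOp (fine n M) (n : ℂ))ᴴ *ᵥ A))).re := by
    rw [hR₁, h3]
  unfold h191 at hexp
  unfold form191
  linarith

end Solution

end

end Literature.MathematicalPhysics.QuantumFieldTheory.Balaban1983to89.B5Eq191LagrangeG
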